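import Summits.QuantumFields.YangMills.Theorems.BalabanUVNodesN05SubBKnitZdLanT8
import Literature.MathematicalPhysics.QuantumFieldTheory.Balaban1983to89.B8Prop3SrcZd3

/-!
# BalabanUVNodes ∕ N05 ([B8], `Dag.B8_main`) — THE SubB KNIT WITH THEOREM 8 SUPPLIED FROM **PRIMITIVE** SOURCED SOCKETS: `BalabanUVNodesN05SubBKnitZdLanT8`
# with its composite hypothesis `SP3src` (Proposition 3 WITH SOURCE — a [Balaban1985RegularSpaces]-OWN statement) DISCHARGED at the law members by seat
# n05-c g4's `B8Prop3SrcZd3.sp3src_zd3_map_of_sockB9P3src` (p495795) from the sourced b9 socket `SB9src` ([Balaban1985BackgroundPropagators] Thm 3.3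
# + (1.57)–(1.58) with source in Prop. 3's frame), so that every displayed input of Theorem 8 is now either Proposition 5 at the sourced gauge condition
# or a [4]-type socket

Track A of `YM-PLAN.md` (cell `pub-ymgap`, HUMAN RULING D-0062), node **N05** = [Balaban1985RegularSpaces] Lemma 1, Thm 2, Prop 3, Thm 4, Props 5–7,
Thm 8; R134 seat `pub-ymgap-dag-n05-d` (g5), 2026-08-27 (dag-lead WORDS-136: knit faces = this seat; bricks = seat `pub-ymgap-dag-n05-c`, whose g4 CLOSE line
«take it by one token at ι := j ↦ j.1.1» this file executes).  Sequel of `BalabanUVNodesN05SubBKnitZdLanT8` (p495285).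

WHAT IS PROVED (composition BY NAME; no estimate; no new definition):
* ★ **`exists_c₁_b8LeafRS_subB_cut_zdLan_of_knit_lettersRDUB_t8sb9src`** — p495285's theorem VERBATIM (same conclusion `∃ c₁ > 0, B8LeafRS …` over `IdxB8SubB θ`)
  EXCEPT: the hypothesis `SP3src` (Prop. 3 with source, threshold `cP3`) is GONE; in its place the sourced b9 socket `SB9src` AT THE LAW MEMBERS (the five
  (1.59)-lines of `B8LeafModelZd3.SockB9P3` for the sourced gauge condition (1.146), with source terms `+ γ″B₀(α₀ + α₁)` on four lines and `+ γβ(α₀ + α₁)` on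
  the Hölder line; premisses «`f ∈ R(U₀)`», `|f|₍₋₂₎, |D f|₍₋₃₎ < γ₈(α₀ + α₁)`), the source constants `γ″ ≥ 0`, `γβ`, the enlarged Hölder constant `B₈β` with
  `5dL·λ.B₀β + 2λ.B₀β·γ″B₀ + γβ ≤ 5dL·B₈β`, and `5dLB₀ + 2γ″B₀ ≤ 5dLB₈` (print p. 101 «only some constants change» — displayed); THE LAYER is now
  `λ.B₁ = 5dL·B₈·(1 + 11d²)`, `λ.B₂ = 5dL·B₈β·(1 + 11d²)`.  Proof: `sp3src_zd3_map_of_sockB9P3src` at `ι := fun j : IdxB8SubB θ => j.1.1` gives `SP3src` with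
  constants `(5dL·B₈, 5dL·B₈β)` and a member-free threshold; `B8Thm8SurvivingZd3Map.thm8SurvivingAt_zd3_map_lan` at `B₀β := B₈β`; `thm8SurvivingAt_anti`
  (γ₈ ↦ 1); p482401 §2 by name.
AFTER THIS FILE the N05 SubB knit displays, besides the record's constant conditions: `p7` (Prop. 7 p. 100; the ONLY printed member of [Balaban1985RegularSpaces]
left as a hypothesis; species word), Proposition 5 ∃∕! AT THE SOURCED GAUGE CONDITION (`SP5base`, `SP5`, `SP5u` — providers = the JOIN twins with the `H′f`
particular solution, located, not in the tree), and [4]-TYPE SOCKETS ONLY: the letters ×4 (`SLet`, `SLetUB`, `SLetC`, `SLetL`, `SLetLU`), the b9 sockets `SB9all`,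
`SB9C`, and the sourced b9 sockets `SH59src` (Thm 4's frame), `SB9src` (Prop. 3's frame) — N06 lineage ∕ J-N06→N05 junction.
HONEST FRAMING: kernel bookkeeping by name; all sockets are HYPOTHESES; `p7` is a HYPOTHESIS = N05's own printed member NOT discharged; count-neutral; **N05 NOT
discharged**; Bałaban AS PRINTED with locators; one finite 𝕋⁴ programme at fixed ε; nothing continuum ∕ ℝ⁴ ∕ OS ∕ mass-gap ∕ Clay.  No `sorry`, no new definition.
Unit `pub-ymgap-dag-n05-d` (g5), 2026-08-27.
[cite: Balaban1985RegularSpaces, Thm 8 (1.146) p.101 («only some constants change»), Prop. 3 p.87 + (1.59)–(1.62) pp.86–87 (supplied with source), Lemma 1 p.79, Thm 2 p.83, Thm 4 p.88, Prop. 5 (1.107)–(1.109) p.94, Prop. 6 (1.131)–(1.138) pp.98–99 (the knit); Prop. 7 p.100 (named hypothesis); Balaban1985BackgroundPropagators, Thm 3.1 p.397, Thm 3.3 p.398, (3.25) p.394 (letters, b9 sockets, sourced b9 sockets — hypotheses)]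
-/

noncomputable section

namespace Summit.QuantumFields.YangMills.BalabanUVNodes.N05SubBKnitZdLanT8B9


open Literature.MathematicalPhysics.QuantumFieldTheory.Balaban1983to89
open Literature.MathematicalPhysics.QuantumFieldTheory.Balaban1983to89.Node00
open Literature.MathematicalPhysics.QuantumFieldTheory.Balaban1983to89.B8IdxB8LawsB (towerBonds IdxB8LawsB IdxB8SubB famB8OfRecordSubB)
open Literature.MathematicalPhysics.QuantumFieldTheory.Balaban1983to89.B8LeafModelZd (ZdIdx)
open Literature.MathematicalPhysics.QuantumFieldTheory.Balaban1983to89.B8LeafModelZd3 (SockB9P3 zdGF3)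
open Literature.MathematicalPhysics.QuantumFieldTheory.Balaban1983to89.B8SockLettersRD (SockLettersRD)
open Literature.MathematicalPhysics.QuantumFieldTheory.Balaban1983to89.B8LeafKnitRS (B8LeafRS)
open Literature.MathematicalPhysics.QuantumFieldTheory.Balaban1983to89.B8Lemma1NonAbelian (blockPairNA mulCfg)
open Literature.MathematicalPhysics.QuantumFieldTheory.Balaban1983to89.B8Eq131CubesAdmissible (cubeFam)
open Literature.MathematicalPhysics.QuantumFieldTheory.Balaban1983to89.B8CubeMemberZd (cubeLamS cubeLamB)
open Literature.MathematicalPhysics.QuantumFieldTheory.Balaban1983to89.B8Prop5LandauDataZd (ZdLanIdx zdLan)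
open Literature.MathematicalPhysics.QuantumFieldTheory.Balaban1983to89.B8Thm8SurvivingZd3Map (thm8SurvivingAt_zd3_map_lan)
open Summit.QuantumFields.YangMills.BalabanUVNodes.N05SubBKnitZdLan (exists_c₁_b8LeafRS_subB_cut_zdLan_of_knit_lettersRDUB)
open MatrixLog B7Prop1Explicit B7Prop2Explicit B7Prop1Local B7Eq92Concrete
open B8Ineq130 (tlo thi)
open B8Ineq132 (InAk covDerivFwd)
open B7Eq78Linearization (zdBlocking QprimeIter)
open B8Eq119TwistedAxial (bgT Restr129 InAx)
open B8Eq140Level (SideTouches)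
open B8Eq138LandauZd (covLap QT IsLandau146W InR138)
open B8Eq1117Concrete (XSpace)
open B8Prop5ContractionKLevel (Bd2)
open B8LambdaSpaceKLevel (wt)
open B8Eq184Proof (gaugeExp cfgExp)
open B8Eq146AExpansion (iEta)
open B7Prop4GeneralLevels (linCovIter)
open B8Eq155JBound (Jcur wsup)
open B8ScaledSupNorm (bondNorm msup)
open Literature.MathematicalPhysics.QuantumFieldTheory.Balaban1983to89.B8Prop3SrcZd3 (sp3src_zd3_map_of_sockB9P3src)
open B8Eq146AExpansion (plaqCovDeriv)
open B8Eq143PlaqExpansion (pdiv)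
open B9Eq340HolderZd (hquot AdmPair)

section KnitT8B9

/-- ★ **THE SURVIVING [B8] LEAF OVER `IdxB8SubB θ` — PROPOSITIONS 5 (both halves) AND 6 SUPPLIED, THEOREM 8 SUPPLIED FROM PRIMITIVE SOURCED SOCKETS.**
`BalabanUVNodesN05SubBKnitZdLanT8.exists_c₁_b8LeafRS_subB_cut_zdLan_of_knit_lettersRDUB_t8src` (p495285) VERBATIM — record residual `λ : ResidB8 θ` with its constant
conditions, [4]'s letters at the law members (`SLet`, guarded `SLetUB`), at their cubes (`SLetC`), at the Prop-5 members `ι : J → ZdLanIdx` (`SLetL`, `SLetLU`) with the three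
member laws, the b9 sockets `SB9all`, `SB9C`, the printed member `p7`, Theorem 8's inputs `cu cP γ₈ γ′ B₈`, `LanF`∕`hLanF`, `SP5base SP5 SH59src SP5u` — EXCEPT: **`SP3src`
(Proposition 3 with source) IS NO LONGER A HYPOTHESIS**; in its place the sourced b9 socket `SB9src` AT THE LAW MEMBERS (`i.Ω 0 = ℤᵈ ∧ IdxB8LawsB θ.L i`), the source
constants `γ″ ≥ 0`, `γβ`, `B₈β` with `5dL·λ.B₀β + 2λ.B₀β·γ″B₀ + γβ ≤ 5dL·B₈β`, `5dLB₀ + 2γ″B₀ ≤ 5dLB₈`, and the layer `λ.B₁ = 5dL·B₈·(1 + 11d²)`,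
`λ.B₂ = 5dL·B₈β·(1 + 11d²)`.  Conclusion unchanged: `∃ c₁ > 0, B8LeafRS …`.  NOT a discharge of N05 (`p7` and all sockets are hypotheses).
[cite: Balaban1985RegularSpaces, Thm 8 (1.146) p.101, Prop. 3 p.87, (1.59)–(1.62) pp.86–87, Thm 2 p.83 («There exist constants B₁, B₂(β₀), c₁»), Prop. 5 (1.107)–(1.109) p.94, Prop. 6 pp.98–99, Lemma 1 p.79, Thm 4 p.88; Prop. 7 p.100 (named hypothesis); Balaban1985BackgroundPropagators, Thm 3.1 p.397, Thm 3.3 p.398, (3.25) p.394 (hypotheses)] -/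
theorem exists_c₁_b8LeafRS_subB_cut_zdLan_of_knit_lettersRDUB_t8sb9src {θ : Stage3Params} (lam : ResidB8 θ) (hD : 2 ≤ θ.D)
    (hB₁' : lam.B₁' = 5 * (θ.D : ℝ) * θ.L * lam.inp.B₀)
    {cB9 B₀'H B₂' BG BR cL : ℝ} (hB : 2 ≤ 5 * (θ.D : ℝ) * θ.L * lam.inp.B₀) (hB₀β : 0 < lam.B₀β) (hC₂ : 2097152 * ((θ.D : ℝ) + 1) ^ 2 ≤ lam.C₂)
    (hcB9 : 0 < cB9) (hB₀'H : 0 < B₀'H) (hB₂' : 0 ≤ B₂') (hBG : 0 ≤ BG) (hBR : 0 ≤ BR) (hcL : 0 < cL)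
    (hfree : 3 * (2 * (θ.D : ℝ) * (θ.L : ℝ) ^ 2) * BG * BR ≤ lam.inp.B₀')
    -- the free-constant condition of the Prop.-5 provider (at half `B₀′`)
    (hfree2 : 3 * (2 * (θ.D : ℝ) * (θ.L : ℝ) ^ 2) * BG * BR ≤ lam.inp.B₀' / 2)
    -- [4]'s letters at the LAW members: existence side (laws on print's domains) and uniqueness side
    (SLet : ∀ i : ZdIdx θ.D θ.L, IdxB8LawsB θ.L i → SockLettersRD (𝔸 := θ.𝔸) θ.L BG BR B₀'H B₂' cL i.η i.k i.Ω i.Λs)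
    (SLetUB : ∀ i : ZdIdx θ.D θ.L, IdxB8LawsB θ.L i → ∀ α₀ : ℝ, 0 < α₀ → α₀ ≤ cL → ∀ U₀ : Site θ.D → Fin θ.D → θ.𝔸ˣ, (∀ x κ, U₀ x κ ∈ unitaryUnits θ.𝔸) →
      InAk θ.L i.k i.η α₀ i.Ω U₀ →
      ∃ (g Δ : (Site θ.D → θ.𝔸) →ₗ[ℂ] (Site θ.D → θ.𝔸)) (q : (Site θ.D → θ.𝔸) →ₗ[ℂ] (ℕ → Site θ.D → θ.𝔸))
        (qs : (ℕ → Site θ.D → θ.𝔸) →ₗ[ℂ] (Site θ.D → θ.𝔸)) (Aw c : (ℕ → Site θ.D → θ.𝔸) →ₗ[ℂ] (ℕ → Site θ.D → θ.𝔸))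
        (H' : XSpace θ.D i.k θ.𝔸 →ₗ[ℂ] (Site θ.D → θ.𝔸)),
        (∀ x : Site θ.D → θ.𝔸, (∃ C : ℝ, ∀ y, ‖x y‖ ≤ C) → g (Δ x + qs (Aw (q x))) = x) ∧ (∀ φ, qs (c (q (g (g (qs φ))))) = qs φ) ∧
        (∀ (f : Site θ.D → θ.𝔸), ∀ x ∈ i.Ω 0, Δ f x = covLap i.η U₀ ((i.Ω 0).indicator f) x) ∧
        (∀ (μ : ℕ → Site θ.D → θ.𝔸), ∀ x ∈ i.Ω 0, qs μ x = QT θ.L i.k (i.Λs i.k) U₀ μ x) ∧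
        (∀ (f : Site θ.D → θ.𝔸) (n : ℕ), n ≤ i.k → ∀ y ∈ i.Λs i.k n, q f n y = QprimeIter (zdBlocking θ.D θ.L) (bgT θ.L U₀) n f y) ∧
        (∀ (f : Site θ.D → θ.𝔸) (n : ℕ) (y : Site θ.D), ¬ (n ≤ i.k ∧ y ∈ i.Λs i.k n) → q f n y = 0) ∧
        (∀ (X : XSpace θ.D i.k θ.𝔸) (x : Site θ.D), ‖H' X x‖ ≤ B₀'H * ‖X‖) ∧
        (∀ n, n ≤ i.k → ∀ (X : XSpace θ.D i.k θ.𝔸), ∀ p ∈ {b : Site θ.D × Fin θ.D | SideTouches (i.Ω n) b.1 b.2},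
          wt θ.L i.η n * ‖covDerivFwd i.η U₀ p.2 (H' X) p.1‖ ≤ B₀'H * ‖X‖) ∧
        (∀ X : XSpace θ.D i.k θ.𝔸, Bd2 θ.L i.η i.k i.Ω (covLap i.η U₀ (H' X)) (B₂' * ‖X‖)) ∧
        (∀ (Y : XSpace θ.D i.k θ.𝔸) (n : ℕ) (hn : n ≤ i.k) (y : Site θ.D), y ∈ i.Λs i.k n →
          QprimeIter (zdBlocking θ.D θ.L) (bgT θ.L U₀) n (H' Y) y = Y (⟨n, Nat.lt_succ_of_le hn⟩, y)) ∧
        (∀ (f : Site θ.D → θ.𝔸) (r : ℝ), 0 ≤ r → Bd2 θ.L i.η i.k i.Ω f r →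
          (∀ x, ‖g f x‖ ≤ BG * r) ∧ ∀ n, n ≤ i.k → ∀ p ∈ {b : Site θ.D × Fin θ.D | SideTouches (i.Ω n) b.1 b.2},
            wt θ.L i.η n * ‖covDerivFwd i.η U₀ p.2 (g f) p.1‖ ≤ BG * r) ∧
        (∀ (f : Site θ.D → θ.𝔸) (r : ℝ), 0 ≤ r → Bd2 θ.L i.η i.k i.Ω f r → Bd2 θ.L i.η i.k i.Ω (f - g (qs (c (q (g f))))) (BR * r)))
    (SB9all : ∀ i : ZdIdx θ.D θ.L, IdxB8LawsB θ.L i → ∀ m, m ≤ i.k →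
      SockB9P3 (𝔸 := θ.𝔸) θ.L lam.inp.B₀ lam.B₀β cB9 lam.β lam.len i.η m i.Ω i.Λs i.Λb)
    -- AT EVERY CUBE of every law member: the existence letters and the b9 socket at the CUBE geometry (finite-Ω₀ members)
    (SLetC : ∀ i : ZdIdx θ.D θ.L, IdxB8LawsB θ.L i → ∀ c : CubeB8 θ.D θ.L i.k i.Ω,
      SockLettersRD (𝔸 := θ.𝔸) θ.L BG BR B₀'H B₂' cL i.η c.k (cubeFam false θ.L c.a c.M c.ρ c.k) (cubeLamS θ.L c.a c.M c.ρ c.k))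
    (SB9C : ∀ i : ZdIdx θ.D θ.L, IdxB8LawsB θ.L i → ∀ c : CubeB8 θ.D θ.L i.k i.Ω, ∀ m, m ≤ c.k →
      SockB9P3 (𝔸 := θ.𝔸) θ.L lam.inp.B₀ lam.B₀β cB9 lam.β lam.len i.η m (cubeFam false θ.L c.a c.M c.ρ c.k) (cubeLamS θ.L c.a c.M c.ρ c.k)
        (cubeLamB θ.L c.a c.M c.ρ c.k))
    -- PROPOSITION 5's INDEX READ AS OBJECTS: `zdLan` members obeying the member laws, with [4]'s letters at each (RD currency)
    {J : Type} (ι : J → ZdLanIdx θ.D θ.𝔸)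
    (hΩ0L : ∀ a : J, (ι a).Ω 0 = Set.univ) (hΩL : ∀ a : J, ∀ j, (ι a).Ω (j + 1) ⊆ (ι a).Ω j)
    (htowerL : ∀ a : J, ∀ j, j ≤ (ι a).k → ∀ y ∈ (ι a).Λ j, ∀ x, InBox (tlo θ.L y j) (thi θ.L y j) x → x ∈ (ι a).Ω j)
    (SLetL : ∀ a : J, ∀ α₀ : ℝ, 0 < α₀ → α₀ ≤ cL → InAk θ.L (ι a).k (ι a).η α₀ (ι a).Ω (ι a).U₀ →
      ∃ (g Δ : (Site θ.D → θ.𝔸) →ₗ[ℂ] (Site θ.D → θ.𝔸)) (q : (Site θ.D → θ.𝔸) →ₗ[ℂ] (ℕ → Site θ.D → θ.𝔸))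
        (qs : (ℕ → Site θ.D → θ.𝔸) →ₗ[ℂ] (Site θ.D → θ.𝔸)) (Aw c : (ℕ → Site θ.D → θ.𝔸) →ₗ[ℂ] (ℕ → Site θ.D → θ.𝔸))
        (H' : XSpace θ.D (ι a).k θ.𝔸 →ₗ[ℂ] (Site θ.D → θ.𝔸)),
        (∀ x, ∀ y ∈ (ι a).Ω 0, (Δ (g x) + qs (Aw (q (g x)))) y = x y) ∧ (∀ f, q (g (g (qs (c (q f))))) = q f) ∧
        (∀ (f : Site θ.D → θ.𝔸), ∀ x ∈ (ι a).Ω 0, Δ f x = covLap (ι a).η (ι a).U₀ (((ι a).Ω 0).indicator f) x) ∧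
        (∀ (μ : ℕ → Site θ.D → θ.𝔸), ∀ x ∈ (ι a).Ω 0, qs μ x = QT θ.L (ι a).k (ι a).Λ (ι a).U₀ μ x) ∧
        (∀ (f : Site θ.D → θ.𝔸) (j : ℕ), j ≤ (ι a).k → ∀ y ∈ (ι a).Λ j, q f j y = QprimeIter (zdBlocking θ.D θ.L) (bgT θ.L (ι a).U₀) j f y) ∧
        (∀ (X : XSpace θ.D (ι a).k θ.𝔸) (x : Site θ.D), ‖H' X x‖ ≤ B₀'H * ‖X‖) ∧
        (∀ j, j ≤ (ι a).k → ∀ (X : XSpace θ.D (ι a).k θ.𝔸), ∀ p ∈ {b : Site θ.D × Fin θ.D | SideTouches ((ι a).Ω j) b.1 b.2},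
          wt θ.L (ι a).η j * ‖covDerivFwd (ι a).η (ι a).U₀ p.2 (H' X) p.1‖ ≤ B₀'H * ‖X‖) ∧
        (∀ X : XSpace θ.D (ι a).k θ.𝔸, Bd2 θ.L (ι a).η (ι a).k (ι a).Ω (covLap (ι a).η (ι a).U₀ (H' X)) (B₂' * ‖X‖)) ∧
        (∀ (X : XSpace θ.D (ι a).k θ.𝔸) (x : Site θ.D), x ∉ (ι a).Ω 0 → H' X x = 0) ∧
        (∀ X Y : XSpace θ.D (ι a).k θ.𝔸, (∀ p, Y p = -star (X p)) → ∀ x, H' Y x = -star (H' X x)) ∧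
        (∀ (Y : XSpace θ.D (ι a).k θ.𝔸) (j : ℕ) (hj : j ≤ (ι a).k) (y : Site θ.D), y ∈ (ι a).Λ j →
          QprimeIter (zdBlocking θ.D θ.L) (bgT θ.L (ι a).U₀) j (H' Y) y = Y (⟨j, Nat.lt_succ_of_le hj⟩, y)) ∧
        (∀ (f : Site θ.D → θ.𝔸) (r : ℝ), 0 ≤ r → Bd2 θ.L (ι a).η (ι a).k (ι a).Ω f r →
          (∀ x, ‖g f x‖ ≤ BG * r) ∧ ∀ j, j ≤ (ι a).k → ∀ p ∈ {b : Site θ.D × Fin θ.D | SideTouches ((ι a).Ω j) b.1 b.2},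
            wt θ.L (ι a).η j * ‖covDerivFwd (ι a).η (ι a).U₀ p.2 (g f) p.1‖ ≤ BG * r) ∧
        (∀ (f : Site θ.D → θ.𝔸) (x : Site θ.D), x ∉ (ι a).Ω 0 → g f x = 0) ∧
        (∀ f : Site θ.D → θ.𝔸, (∀ j, j ≤ (ι a).k → ∀ x ∈ (ι a).Ω j, IsSelfAdjoint (f x)) → ∀ x, IsSelfAdjoint (g f x)) ∧
        (∀ (f : Site θ.D → θ.𝔸) (r : ℝ), 0 ≤ r → Bd2 θ.L (ι a).η (ι a).k (ι a).Ω f r →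
          Bd2 θ.L (ι a).η (ι a).k (ι a).Ω (f - g (qs (c (q (g f))))) (BR * r)) ∧
        (∀ f : Site θ.D → θ.𝔸, (∀ j, j ≤ (ι a).k → ∀ x ∈ (ι a).Ω j, IsSelfAdjoint (f x)) →
          ∀ j, j ≤ (ι a).k → ∀ x ∈ (ι a).Ω j, IsSelfAdjoint ((f - g (qs (c (q (g f))))) x)))
    -- [4]'s UNIQUENESS letters at the Prop-5 members (left-inverse law of G′ on bounded functions), for Prop. 5's uniqueness clause there
    (SLetLU : ∀ a : J, ∀ α₀ : ℝ, 0 < α₀ → α₀ ≤ cL → InAk θ.L (ι a).k (ι a).η α₀ (ι a).Ω (ι a).U₀ →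
      ∃ (g Δ : (Site θ.D → θ.𝔸) →ₗ[ℂ] (Site θ.D → θ.𝔸)) (q : (Site θ.D → θ.𝔸) →ₗ[ℂ] (ℕ → Site θ.D → θ.𝔸)) (qs : (ℕ → Site θ.D → θ.𝔸) →ₗ[ℂ] (Site θ.D → θ.𝔸))
        (Aw c : (ℕ → Site θ.D → θ.𝔸) →ₗ[ℂ] (ℕ → Site θ.D → θ.𝔸)) (H' : XSpace θ.D (ι a).k θ.𝔸 →ₗ[ℂ] (Site θ.D → θ.𝔸)),
        (∀ x : Site θ.D → θ.𝔸, (∃ C : ℝ, ∀ y, ‖x y‖ ≤ C) → g (Δ x + qs (Aw (q x))) = x) ∧ (∀ φ, qs (c (q (g (g (qs φ))))) = qs φ) ∧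
        (∀ (f : Site θ.D → θ.𝔸), ∀ x ∈ (ι a).Ω 0, Δ f x = covLap (ι a).η (ι a).U₀ (((ι a).Ω 0).indicator f) x) ∧
        (∀ (μ : ℕ → Site θ.D → θ.𝔸), ∀ x ∈ (ι a).Ω 0, qs μ x = QT θ.L (ι a).k (ι a).Λ (ι a).U₀ μ x) ∧
        (∀ (f : Site θ.D → θ.𝔸) (n : ℕ), n ≤ (ι a).k → ∀ y ∈ (ι a).Λ n, q f n y = QprimeIter (zdBlocking θ.D θ.L) (bgT θ.L (ι a).U₀) n f y) ∧
        (∀ (f : Site θ.D → θ.𝔸) (n : ℕ) (y : Site θ.D), ¬ (n ≤ (ι a).k ∧ y ∈ (ι a).Λ n) → q f n y = 0) ∧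
        (∀ (X : XSpace θ.D (ι a).k θ.𝔸) (x : Site θ.D), ‖H' X x‖ ≤ B₀'H * ‖X‖) ∧
        (∀ n, n ≤ (ι a).k → ∀ (X : XSpace θ.D (ι a).k θ.𝔸), ∀ p ∈ {b : Site θ.D × Fin θ.D | SideTouches ((ι a).Ω n) b.1 b.2},
          wt θ.L (ι a).η n * ‖covDerivFwd (ι a).η (ι a).U₀ p.2 (H' X) p.1‖ ≤ B₀'H * ‖X‖) ∧
        (∀ X : XSpace θ.D (ι a).k θ.𝔸, Bd2 θ.L (ι a).η (ι a).k (ι a).Ω (covLap (ι a).η (ι a).U₀ (H' X)) (B₂' * ‖X‖)) ∧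
        (∀ (Y : XSpace θ.D (ι a).k θ.𝔸) (n : ℕ) (hn : n ≤ (ι a).k) (y : Site θ.D), y ∈ (ι a).Λ n →
          QprimeIter (zdBlocking θ.D θ.L) (bgT θ.L (ι a).U₀) n (H' Y) y = Y (⟨n, Nat.lt_succ_of_le hn⟩, y)) ∧
        (∀ (f : Site θ.D → θ.𝔸) (r : ℝ), 0 ≤ r → Bd2 θ.L (ι a).η (ι a).k (ι a).Ω f r →
          (∀ x, ‖g f x‖ ≤ BG * r) ∧ ∀ n, n ≤ (ι a).k → ∀ p ∈ {b : Site θ.D × Fin θ.D | SideTouches ((ι a).Ω n) b.1 b.2},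
            wt θ.L (ι a).η n * ‖covDerivFwd (ι a).η (ι a).U₀ p.2 (g f) p.1‖ ≤ BG * r) ∧
        (∀ (f : Site θ.D → θ.𝔸) (r : ℝ), 0 ≤ r → Bd2 θ.L (ι a).η (ι a).k (ι a).Ω f r →
          Bd2 θ.L (ι a).η (ι a).k (ι a).Ω (f - g (qs (c (q (g f))))) (BR * r)))
    -- the remaining printed member (Prop. 7 p. 100; species word)
    (p7 : B8SectGH.Prop7PrintedR (fun j : IdxB8SubB θ => famB8OfRecordSubB θ lam.β lam.len j) (fun j => lam.toAxial j.1))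
    -- THEOREM 8's PRIMITIVE INPUTS AT THE LAW MEMBERS (replacing the printed member `t8`): constants, the source-indexed gauge predicate with its
    -- top-level clause (1.146), and five SOURCED SOCKETS — Prop. 5 ∃ (`SP5base`, `SP5`) and Prop. 5 ! (`SP5u`) at the sourced gauge condition, [4] Thm 3.3
    -- WITH SOURCE in Thm 4's frame (`SH59src`) and in Prop. 3's frame (`SB9src`, all five (1.59)-lines) — each demanded ONLY at members `i` with
    -- `Ω₀ = ℤᵈ` obeying the four laws (`IdxB8LawsB`), i.e. on `IdxB8SubB θ`
    {cu cP γ₈ γ' γ'' γβ B₈ B₈β : ℝ} (hcu : 0 < cu) (hcP : 0 < cP) (hγ₈ : 1 ≤ γ₈) (hγ' : 0 ≤ γ') (hγ'' : 0 ≤ γ'') (hB₀8 : lam.inp.B₀ ≤ B₈)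
    (hγB : 5 * (θ.D : ℝ) * θ.L * lam.inp.B₀ + 2 * (γ' * lam.inp.B₀) ≤ 5 * (θ.D : ℝ) * θ.L * B₈)
    (hγB'' : 5 * (θ.D : ℝ) * θ.L * lam.inp.B₀ + 2 * (γ'' * lam.inp.B₀) ≤ 5 * (θ.D : ℝ) * θ.L * B₈)
    (hB8β : 5 * (θ.D : ℝ) * θ.L * lam.B₀β + 2 * lam.B₀β * (γ'' * lam.inp.B₀) + γβ ≤ 5 * (θ.D : ℝ) * θ.L * B₈β)
    (hB₁eq : lam.B₁ = 5 * (θ.D : ℝ) * θ.L * B₈ * (1 + 11 * (θ.D : ℝ) ^ 2)) (hB₂eq : lam.B₂ = 5 * (θ.D : ℝ) * θ.L * B₈β * (1 + 11 * (θ.D : ℝ) ^ 2))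
    (LanF : ZdIdx θ.D θ.L → (Site θ.D → Fin θ.D → θ.𝔸ˣ) → (Site θ.D → θ.𝔸) → ℕ → (Site θ.D → Fin θ.D → θ.𝔸ˣ) → Prop)
    (hLanF : ∀ i : ZdIdx θ.D θ.L, i.Ω 0 = Set.univ → IdxB8LawsB θ.L i →
      ∀ (U₀ : Site θ.D → Fin θ.D → θ.𝔸ˣ) (f : Site θ.D → θ.𝔸) (W : Site θ.D → Fin θ.D → θ.𝔸ˣ), LanF i U₀ f i.k W ↔ IsLandau146W θ.L i.k i.η (i.Ω 0) (i.Λs i.k) U₀ f W)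
    (SP5base : ∀ i : ZdIdx θ.D θ.L, i.Ω 0 = Set.univ → IdxB8LawsB θ.L i → ∀ α₀ α₁ : ℝ, 0 < α₀ → 0 < α₁ → α₀ + α₁ ≤ cP →
      ∀ U₀ U' : Site θ.D → Fin θ.D → θ.𝔸ˣ, (∀ x κ, U₀ x κ ∈ unitaryUnits θ.𝔸) → (∀ x κ, U' x κ ∈ unitaryUnits θ.𝔸) →
      ∀ φ : Site θ.D → θ.𝔸, (InR138 θ.L i.k i.η (i.Ω 0) (i.Λs i.k) U₀ φ ∧
        msup θ.L i.k i.η (-(2 : ℝ)) (fun j (x : Site θ.D) => x ∈ i.Ω j) φ < γ₈ * (α₀ + α₁)) →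
      InAk θ.L i.k i.η α₀ i.Ω U₀ → InAk θ.L i.k i.η α₀ i.Ω (mulCfg U' U₀) → (∀ m, m ≤ i.k → InAx θ.L m (i.Λs m) U₀ (mulCfg U' U₀)) →
      (∀ j, j ≤ i.k → ∀ (z : Site θ.D) (μ : Fin θ.D), (∀ x, InBox (loK θ.L j z) (bondHiK θ.L j z μ) x → x ∈ i.Ω j) →
        ‖(avgIter θ.L (mulCfg U' U₀) j z μ : θ.𝔸) - (avgIter θ.L U₀ j z μ : θ.𝔸)‖ ≤ α₁) →
      (∀ b ∈ {b : Site θ.D × Fin θ.D | SideTouches (i.Ω 0) b.1 b.2}, ‖((U' b.1 b.2 : θ.𝔸ˣ) : θ.𝔸) - 1‖ ≤ α₁) →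
      (∃ (v : Site θ.D → θ.𝔸ˣ) (lm : Site θ.D → θ.𝔸), (∀ x, v x ∈ unitaryUnits θ.𝔸) ∧ (∀ x, x ∉ i.Ω 0 → v x = 1) ∧
        (∀ j, j ≤ 1 → ∀ b ∈ {b : Site θ.D × Fin θ.D | SideTouches (i.Ω j) b.1 b.2}, (v b.1 : θ.𝔸) = ((gaugeExp lm b.1 : θ.𝔸ˣ) : θ.𝔸) ∧
        (v (b.1 + e b.2) : θ.𝔸) = ((gaugeExp lm (b.1 + e b.2) : θ.𝔸ˣ) : θ.𝔸)) ∧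
        (∀ j, j ≤ 1 → ∀ b ∈ {b : Site θ.D × Fin θ.D | SideTouches (i.Ω j) b.1 b.2},
        ‖lm b.1‖ ≤ (8 * lam.inp.B₀' * (5 * (θ.D : ℝ) * θ.L * B₈) * (α₀ + α₁)) ∧ ((θ.L : ℝ) ^ j * i.η) * ‖covDerivFwd i.η U₀ b.2 lm b.1‖ ≤ (8 * lam.inp.B₀' * (5 * (θ.D : ℝ) * θ.L * B₈) * (α₀ + α₁))) ∧
        LanF i U₀ φ 1 (mgauge U₀ v⁻¹ U') ∧ Restr129 θ.L 1 (i.Λs 1) U₀ ((1 : Site θ.D → θ.𝔸ˣ) * v)))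
    (SP5 : ∀ i : ZdIdx θ.D θ.L, i.Ω 0 = Set.univ → IdxB8LawsB θ.L i → ∀ α₀ α₁ : ℝ, 0 < α₀ → 0 < α₁ → α₀ + α₁ ≤ cP →
      ∀ U₀ U' : Site θ.D → Fin θ.D → θ.𝔸ˣ, (∀ x κ, U₀ x κ ∈ unitaryUnits θ.𝔸) → (∀ x κ, U' x κ ∈ unitaryUnits θ.𝔸) →
      ∀ φ : Site θ.D → θ.𝔸, (InR138 θ.L i.k i.η (i.Ω 0) (i.Λs i.k) U₀ φ ∧
        msup θ.L i.k i.η (-(2 : ℝ)) (fun j (x : Site θ.D) => x ∈ i.Ω j) φ < γ₈ * (α₀ + α₁)) →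
      InAk θ.L i.k i.η α₀ i.Ω U₀ → InAk θ.L i.k i.η α₀ i.Ω (mulCfg U' U₀) → (∀ m, m ≤ i.k → InAx θ.L m (i.Λs m) U₀ (mulCfg U' U₀)) →
      (∀ j, j ≤ i.k → ∀ (z : Site θ.D) (μ : Fin θ.D), (∀ x, InBox (loK θ.L j z) (bondHiK θ.L j z μ) x → x ∈ i.Ω j) →
        ‖(avgIter θ.L (mulCfg U' U₀) j z μ : θ.𝔸) - (avgIter θ.L U₀ j z μ : θ.𝔸)‖ ≤ α₁) →
      (∀ b ∈ {b : Site θ.D × Fin θ.D | SideTouches (i.Ω 0) b.1 b.2}, ‖((U' b.1 b.2 : θ.𝔸ˣ) : θ.𝔸) - 1‖ ≤ α₁) →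
      (∀ m, 1 ≤ m → m < i.k → ∀ (u₁ : Site θ.D → θ.𝔸ˣ) (U₁ : Site θ.D → Fin θ.D → θ.𝔸ˣ) (A : Site θ.D → Fin θ.D → θ.𝔸),
        (∀ x, u₁ x ∈ unitaryUnits θ.𝔸) → (∀ x, x ∉ i.Ω 0 → u₁ x = 1) → mgauge U₀ u₁ U₁ = U' → Restr129 θ.L m (i.Λs m) U₀ u₁ →
        LanF i U₀ φ m U₁ →
        (∀ j, j ≤ m → ∀ b ∈ {b : Site θ.D × Fin θ.D | SideTouches (i.Ω j) b.1 b.2},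
        U₁ b.1 b.2 = cfgExp i.η A b.1 b.2 ∧ IsSelfAdjoint (A b.1 b.2) ∧ ‖A b.1 b.2‖ ≤ (5 * (θ.D : ℝ) * θ.L * B₈ * (α₀ + α₁)) * ((θ.L : ℝ) ^ j * i.η)⁻¹) →
        ∃ (v : Site θ.D → θ.𝔸ˣ) (lm : Site θ.D → θ.𝔸), (∀ x, v x ∈ unitaryUnits θ.𝔸) ∧ (∀ x, x ∉ i.Ω 0 → v x = 1) ∧
        (∀ j, j ≤ m + 1 → ∀ b ∈ {b : Site θ.D × Fin θ.D | SideTouches (i.Ω j) b.1 b.2}, (v b.1 : θ.𝔸) = ((gaugeExp lm b.1 : θ.𝔸ˣ) : θ.𝔸) ∧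
        (v (b.1 + e b.2) : θ.𝔸) = ((gaugeExp lm (b.1 + e b.2) : θ.𝔸ˣ) : θ.𝔸)) ∧
        (∀ j, j ≤ m + 1 → ∀ b ∈ {b : Site θ.D × Fin θ.D | SideTouches (i.Ω j) b.1 b.2},
        ‖lm b.1‖ ≤ (8 * lam.inp.B₀' * (5 * (θ.D : ℝ) * θ.L * B₈) * (α₀ + α₁)) ∧ ((θ.L : ℝ) ^ j * i.η) * ‖covDerivFwd i.η U₀ b.2 lm b.1‖ ≤ (8 * lam.inp.B₀' * (5 * (θ.D : ℝ) * θ.L * B₈) * (α₀ + α₁))) ∧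
        LanF i U₀ φ (m + 1) (mgauge U₀ v⁻¹ U₁) ∧ Restr129 θ.L (m + 1) (i.Λs (m + 1)) U₀ (u₁ * v)))
    (SH59src : ∀ i : ZdIdx θ.D θ.L, i.Ω 0 = Set.univ → IdxB8LawsB θ.L i → ∀ α₀ α₁ : ℝ, 0 < α₀ → 0 < α₁ → α₀ + α₁ ≤ cP →
      ∀ U₀ U' : Site θ.D → Fin θ.D → θ.𝔸ˣ, (∀ x κ, U₀ x κ ∈ unitaryUnits θ.𝔸) → (∀ x κ, U' x κ ∈ unitaryUnits θ.𝔸) →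
      ∀ φ : Site θ.D → θ.𝔸, (InR138 θ.L i.k i.η (i.Ω 0) (i.Λs i.k) U₀ φ ∧
        msup θ.L i.k i.η (-(2 : ℝ)) (fun j (x : Site θ.D) => x ∈ i.Ω j) φ < γ₈ * (α₀ + α₁)) →
      InAk θ.L i.k i.η α₀ i.Ω U₀ → InAk θ.L i.k i.η α₀ i.Ω (mulCfg U' U₀) → (∀ m, m ≤ i.k → InAx θ.L m (i.Λs m) U₀ (mulCfg U' U₀)) →
      (∀ j, j ≤ i.k → ∀ (z : Site θ.D) (μ : Fin θ.D), (∀ x, InBox (loK θ.L j z) (bondHiK θ.L j z μ) x → x ∈ i.Ω j) →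
        ‖(avgIter θ.L (mulCfg U' U₀) j z μ : θ.𝔸) - (avgIter θ.L U₀ j z μ : θ.𝔸)‖ ≤ α₁) →
      (∀ b ∈ {b : Site θ.D × Fin θ.D | SideTouches (i.Ω 0) b.1 b.2}, ‖((U' b.1 b.2 : θ.𝔸ˣ) : θ.𝔸) - 1‖ ≤ α₁) →
      (∀ m, 1 ≤ m → m ≤ i.k → ∀ (u : Site θ.D → θ.𝔸ˣ) (W : Site θ.D → Fin θ.D → θ.𝔸ˣ) (A' : Site θ.D → Fin θ.D → θ.𝔸),
        (∀ x, u x ∈ unitaryUnits θ.𝔸) → mgauge U₀ u W = U' → Restr129 θ.L m (i.Λs m) U₀ u → LanF i U₀ φ m W →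
        (∀ y τ, IsSelfAdjoint (A' y τ)) →
        (∀ j, j ≤ m → ∀ y τ, SideTouches (i.Ω j) y τ →
        W y τ = cfgExp i.η A' y τ ∧ ‖A' y τ‖ ≤ (2 * (θ.L * (5 * (θ.D : ℝ) * θ.L * B₈ * (α₀ + α₁))) + 8 * (8 * lam.inp.B₀' * (5 * (θ.D : ℝ) * θ.L * B₈) * (α₀ + α₁))) * ((θ.L : ℝ) ^ j * i.η)⁻¹) →
        (∀ y τ, (∀ j, j ≤ m → ¬ SideTouches (i.Ω j) y τ) → A' y τ = 0) →
        msup θ.L m i.η (-(1 : ℝ)) (fun j (b : Site θ.D × Fin θ.D) => SideTouches (i.Ω j) b.1 b.2) (fun b => A' b.1 b.2)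
        ≤ lam.inp.B₀ * (bondNorm θ.L m i.η (-(3 : ℝ)) i.Ω (fun x μ => Jcur i.η U₀ A' μ x)
        + wsup 1 (fun p : {p : ℕ × (Site θ.D × Fin θ.D) // p.1 ≤ m ∧ p.2 ∈ i.Λb m p.1} =>
        linCovIter θ.L U₀ (iEta i.η A') p.1.1 p.1.2.1 p.1.2.2)) + γ' * lam.inp.B₀ * (α₀ + α₁) ∧
        msup θ.L m i.η (-(2 : ℝ)) (fun j (t : Fin θ.D × Fin θ.D × Site θ.D) => SideTouches (i.Ω j) t.2.2 t.2.1)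
        (fun t => covDerivFwd i.η U₀ t.1 (fun z => A' z t.2.1) t.2.2)
        ≤ lam.inp.B₀ * (bondNorm θ.L m i.η (-(3 : ℝ)) i.Ω (fun x μ => Jcur i.η U₀ A' μ x)
        + wsup 1 (fun p : {p : ℕ × (Site θ.D × Fin θ.D) // p.1 ≤ m ∧ p.2 ∈ i.Λb m p.1} =>
        linCovIter θ.L U₀ (iEta i.η A') p.1.1 p.1.2.1 p.1.2.2)) + γ' * lam.inp.B₀ * (α₀ + α₁)))
    (SP5u : ∀ i : ZdIdx θ.D θ.L, i.Ω 0 = Set.univ → IdxB8LawsB θ.L i → ∀ α₀ α₁ : ℝ, 0 < α₀ → 0 < α₁ → α₀ + α₁ ≤ cP →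
      ∀ U₀ U' : Site θ.D → Fin θ.D → θ.𝔸ˣ, (∀ x κ, U₀ x κ ∈ unitaryUnits θ.𝔸) → (∀ x κ, U' x κ ∈ unitaryUnits θ.𝔸) →
      ∀ φ : Site θ.D → θ.𝔸, (InR138 θ.L i.k i.η (i.Ω 0) (i.Λs i.k) U₀ φ ∧
        msup θ.L i.k i.η (-(2 : ℝ)) (fun j (x : Site θ.D) => x ∈ i.Ω j) φ < γ₈ * (α₀ + α₁)) →
      InAk θ.L i.k i.η α₀ i.Ω U₀ → InAk θ.L i.k i.η α₀ i.Ω (mulCfg U' U₀) → (∀ m, m ≤ i.k → InAx θ.L m (i.Λs m) U₀ (mulCfg U' U₀)) →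
      (∀ j, j ≤ i.k → ∀ (z : Site θ.D) (μ : Fin θ.D), (∀ x, InBox (loK θ.L j z) (bondHiK θ.L j z μ) x → x ∈ i.Ω j) →
        ‖(avgIter θ.L (mulCfg U' U₀) j z μ : θ.𝔸) - (avgIter θ.L U₀ j z μ : θ.𝔸)‖ ≤ α₁) →
      (∀ b ∈ {b : Site θ.D × Fin θ.D | SideTouches (i.Ω 0) b.1 b.2}, ‖((U' b.1 b.2 : θ.𝔸ˣ) : θ.𝔸) - 1‖ ≤ α₁) →
      ∀ u₁ : Site θ.D → θ.𝔸ˣ, (∀ x, u₁ x ∈ unitaryUnits θ.𝔸) → Restr129 θ.L i.k (i.Λs i.k) U₀ u₁ →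
      ∀ (v w : Site θ.D → θ.𝔸ˣ) (lm mu : Site θ.D → θ.𝔸),
      (∀ j, j ≤ i.k → ∀ y ∈ i.Λs i.k j, ∀ x : Site θ.D, InBox (tlo θ.L y j) (thi θ.L y j) x →
        ((gaugeExp lm x : θ.𝔸ˣ) : θ.𝔸) = ((v x : θ.𝔸ˣ) : θ.𝔸) ∧ IsSelfAdjoint (lm x) ∧ ‖lm x‖ < cu ∧
          ∀ κ : Fin θ.D, InBox (tlo θ.L y j) (thi θ.L y j) (x + e κ) → ((θ.L : ℝ) ^ j * i.η) * ‖covDerivFwd i.η U₀ κ lm x‖ < cu) →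
      (∀ j, j ≤ i.k → ∀ y ∈ i.Λs i.k j, ∀ x : Site θ.D, InBox (tlo θ.L y j) (thi θ.L y j) x →
        ((gaugeExp mu x : θ.𝔸ˣ) : θ.𝔸) = ((w x : θ.𝔸ˣ) : θ.𝔸) ∧ IsSelfAdjoint (mu x) ∧ ‖mu x‖ < cu ∧
          ∀ κ : Fin θ.D, InBox (tlo θ.L y j) (thi θ.L y j) (x + e κ) → ((θ.L : ℝ) ^ j * i.η) * ‖covDerivFwd i.η U₀ κ mu x‖ < cu) →
      LanF i U₀ φ i.k (mgauge U₀ v⁻¹ (mgauge U₀ u₁⁻¹ U')) → Restr129 θ.L i.k (i.Λs i.k) U₀ (u₁ * v) →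
      LanF i U₀ φ i.k (mgauge U₀ w⁻¹ (mgauge U₀ u₁⁻¹ U')) → Restr129 θ.L i.k (i.Λs i.k) U₀ (u₁ * w) →
      ∀ j, j ≤ i.k → ∀ y ∈ i.Λs i.k j, ∀ x : Site θ.D, InBox (tlo θ.L y j) (thi θ.L y j) x → v x = w x)
    (SB9src : ∀ i : ZdIdx θ.D θ.L, i.Ω 0 = Set.univ → IdxB8LawsB θ.L i → ∀ α₀ α₁ α₂ : ℝ, 0 < α₀ → α₀ ≤ cP → 0 < α₁ → 0 < α₂ → α₂ ≤ cP →
      ∀ (U₀ W : Site θ.D → Fin θ.D → θ.𝔸ˣ), (∀ x κ, U₀ x κ ∈ unitaryUnits θ.𝔸) → (∀ x κ, W x κ ∈ unitaryUnits θ.𝔸) →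
      ∀ f : Site θ.D → θ.𝔸, InR138 θ.L i.k i.η (i.Ω 0) (i.Λs i.k) U₀ f →
      msup θ.L i.k i.η (-(2 : ℝ)) (fun j (x : Site θ.D) => x ∈ i.Ω j) f < γ₈ * (α₀ + α₁) →
      msup θ.L i.k i.η (-(3 : ℝ)) (fun j (p : Fin θ.D × Site θ.D) => p.2 ∈ i.Ω j) (fun p => covDerivFwd i.η U₀ p.1 f p.2) < γ₈ * (α₀ + α₁) →
      InAk θ.L i.k i.η α₀ i.Ω U₀ → InAk θ.L i.k i.η α₀ i.Ω (mulCfg W U₀) → IsLandau146W θ.L i.k i.η (i.Ω 0) (i.Λs i.k) U₀ f W →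
      ∀ A' : Site θ.D → Fin θ.D → θ.𝔸, (∀ y τ, IsSelfAdjoint (A' y τ)) →
      (∀ j, j ≤ i.k → ∀ (y : Site θ.D) (τ : Fin θ.D), SideTouches (i.Ω j) y τ →
        W y τ = cfgExp i.η A' y τ ∧ ‖A' y τ‖ ≤ α₂ * ((θ.L : ℝ) ^ j * i.η)⁻¹) →
      (∀ (y : Site θ.D) (τ : Fin θ.D), (∀ j, j ≤ i.k → ¬ SideTouches (i.Ω j) y τ) → A' y τ = 0) →
      msup θ.L i.k i.η (-(1 : ℝ)) (fun j (b : Site θ.D × Fin θ.D) => SideTouches (i.Ω j) b.1 b.2) (fun b => A' b.1 b.2)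
          ≤ lam.inp.B₀ * (bondNorm θ.L i.k i.η (-(3 : ℝ)) i.Ω (fun x μ => Jcur i.η U₀ A' μ x)
            + wsup 1 (fun p : {p : ℕ × (Site θ.D × Fin θ.D) // p.1 ≤ i.k ∧ p.2 ∈ i.Λb i.k p.1} =>
                linCovIter θ.L U₀ (iEta i.η A') p.1.1 p.1.2.1 p.1.2.2)) + γ'' * lam.inp.B₀ * (α₀ + α₁) ∧
        msup θ.L i.k i.η (-(2 : ℝ)) (fun j (t : Fin θ.D × Fin θ.D × Site θ.D) => SideTouches (i.Ω j) t.2.2 t.2.1)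
            (fun t => covDerivFwd i.η U₀ t.1 (fun z => A' z t.2.1) t.2.2)
          ≤ lam.inp.B₀ * (bondNorm θ.L i.k i.η (-(3 : ℝ)) i.Ω (fun x μ => Jcur i.η U₀ A' μ x)
            + wsup 1 (fun p : {p : ℕ × (Site θ.D × Fin θ.D) // p.1 ≤ i.k ∧ p.2 ∈ i.Λb i.k p.1} =>
                linCovIter θ.L U₀ (iEta i.η A') p.1.1 p.1.2.1 p.1.2.2)) + γ'' * lam.inp.B₀ * (α₀ + α₁) ∧
        bondNorm θ.L i.k i.η (-(3 : ℝ)) i.Ω (fun x μ => pdiv i.η U₀ (plaqCovDeriv i.η U₀ A') μ x)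
          ≤ lam.inp.B₀ * (bondNorm θ.L i.k i.η (-(3 : ℝ)) i.Ω (fun x μ => Jcur i.η U₀ A' μ x)
            + wsup 1 (fun p : {p : ℕ × (Site θ.D × Fin θ.D) // p.1 ≤ i.k ∧ p.2 ∈ i.Λb i.k p.1} =>
                linCovIter θ.L U₀ (iEta i.η A') p.1.1 p.1.2.1 p.1.2.2)) + γ'' * lam.inp.B₀ * (α₀ + α₁) ∧
        bondNorm θ.L i.k i.η (-(3 : ℝ)) i.Ω (fun x μ => covLap i.η U₀ (fun z => A' z μ) x)
          ≤ lam.inp.B₀ * (bondNorm θ.L i.k i.η (-(3 : ℝ)) i.Ω (fun x μ => Jcur i.η U₀ A' μ x)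
            + wsup 1 (fun p : {p : ℕ × (Site θ.D × Fin θ.D) // p.1 ≤ i.k ∧ p.2 ∈ i.Λb i.k p.1} =>
                linCovIter θ.L U₀ (iEta i.η A') p.1.1 p.1.2.1 p.1.2.2)) + γ'' * lam.inp.B₀ * (α₀ + α₁) ∧
        msup θ.L i.k i.η (-(2 + lam.β)) (fun j (q : Fin θ.D × Fin θ.D × (Site θ.D × Site θ.D)) => q.2.2 ∈ AdmPair i.η lam.len ∧ q.2.2.1 ∈ i.Ω j)
            (fun q => hquot i.η lam.β lam.len U₀ (covDerivFwd i.η U₀ q.1 (fun z => A' z q.2.1)) q.2.2)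
          ≤ lam.B₀β * (bondNorm θ.L i.k i.η (-(3 : ℝ)) i.Ω (fun x μ => Jcur i.η U₀ A' μ x)
            + wsup 1 (fun p : {p : ℕ × (Site θ.D × Fin θ.D) // p.1 ≤ i.k ∧ p.2 ∈ i.Λb i.k p.1} =>
                linCovIter θ.L U₀ (iEta i.η A') p.1.1 p.1.2.1 p.1.2.2)) + γβ * (α₀ + α₁)) :
    ∃ c₁ : ℝ, 0 < c₁ ∧
      B8LeafRS θ.D (θ.L : ℝ) lam.C₂ lam.B₁' lam.inp.B₀' lam.B₁ lam.B₂ c₁ lam.inp lam.B₀β (blockPairNA θ.D θ.L θ.𝔸)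
        (fun j : IdxB8SubB θ => famB8OfRecordSubB θ lam.β lam.len j) (fun a : J => zdLan θ.L lam.B₁ (ι a))
        (fun j : IdxB8SubB θ => cubB8OfRecord θ j.1) (fun j => lam.toAxial j.1) := by
  -- constants: `0 < B₀ ≤ B₈`, `2 ≤ 5dLB₀ ≤ 5dLB₈ ≤ λ.B₁`
  have hB₀ : 0 < lam.inp.B₀ := lam.inp.B₀_pos
  have hB₈ : 0 < B₈ := lt_of_lt_of_le hB₀ hB₀8
  have h5 : 0 ≤ 5 * (θ.D : ℝ) * θ.L := by positivity
  have hB8' : 2 ≤ 5 * (θ.D : ℝ) * θ.L * B₈ := hB.trans (mul_le_mul_of_nonneg_left hB₀8 h5)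
  have hD1 : (1 : ℝ) ≤ 1 + 11 * (θ.D : ℝ) ^ 2 := le_add_of_nonneg_right (by positivity)
  have hB₁ : 5 * (θ.D : ℝ) * θ.L * lam.inp.B₀ ≤ lam.B₁ := by
    rw [hB₁eq]
    calc 5 * (θ.D : ℝ) * θ.L * lam.inp.B₀ ≤ 5 * (θ.D : ℝ) * θ.L * B₈ := mul_le_mul_of_nonneg_left hB₀8 h5
      _ = 5 * (θ.D : ℝ) * θ.L * B₈ * 1 := (mul_one _).symm
      _ ≤ 5 * (θ.D : ℝ) * θ.L * B₈ * (1 + 11 * (θ.D : ℝ) ^ 2) := mul_le_mul_of_nonneg_left hD1 (by positivity)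
  have hB₁2 : 2 ≤ lam.B₁ := hB.trans hB₁
  -- PROPOSITION 3 WITH SOURCE at the law members from the sourced b9 socket in Prop. 3's frame (n05-c g4's brick 5, re-keyed): `SP3src` at `ι := j ↦ j.1.1`
  obtain ⟨cP3, hcP3, SP3src⟩ := sp3src_zd3_map_of_sockB9P3src (𝔸 := θ.𝔸) (γ := γ₈) hD θ.two_le_L hB₀ hB₀β.le hcP hγ'' hγB'' hB8β lam.β lam.len
    (fun j : IdxB8SubB θ => j.1.1) (fun j => SB9src j.1.1 j.1.2 j.2)
  -- THEOREM 8 (surviving) at the law members from the sourced sockets: `thm8SurvivingAt_zd3_map_lan` at `ι := fun j : IdxB8SubB θ => j.1.1`, then `γ₈ ↦ 1`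
  have t8γ := thm8SurvivingAt_zd3_map_lan (𝔸 := θ.𝔸) (β := lam.β) (len := lam.len) hD θ.two_le_L hB₀ lam.inp.B₀'_pos hcu hcP hcP3
    (lt_of_lt_of_le one_pos hγ₈) hγ' hB₈ hB₀8 hB8' hγB (fun j : IdxB8SubB θ => j.1.1) (fun j => j.1.2) (fun j => LanF j.1.1)
    (fun j => hLanF j.1.1 j.1.2 j.2) (fun j => SP5base j.1.1 j.1.2 j.2) (fun j => SP5 j.1.1 j.1.2 j.2) (fun j => SH59src j.1.1 j.1.2 j.2)
    (fun j => SP5u j.1.1 j.1.2 j.2) SP3src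
  have t8 : B8Thm8Surviving.Thm8SurvivingAt 1 lam.B₁ lam.B₂ (fun j : IdxB8SubB θ => famB8OfRecordSubB θ lam.β lam.len j) := by
    rw [hB₁eq, hB₂eq]
    exact B8Thm8Surviving.thm8SurvivingAt_anti _ hγ₈ t8γ
  -- p482401 §2 by name
  exact exists_c₁_b8LeafRS_subB_cut_zdLan_of_knit_lettersRDUB lam hD hB₁' hB₁ hB hB₀β hC₂ hcB9 hB₀'H hB₂' hBG hBR hcL hfree hB₁2 hfree2
    SLet SLetUB SB9all SLetC SB9C ι hΩ0L hΩL htowerL SLetL SLetLU p7 t8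

end KnitT8B9

end Summit.QuantumFields.YangMills.BalabanUVNodes.N05SubBKnitZdLanT8B9

end
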